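import Literature.AlgebraicGeometry.Morphisms.ClosedImmersionOfInfinitesimalFactorisations
import Mathlib.AlgebraicGeometry.SpreadingOut
import HarnessLib

/-!
# A closed subscheme through which all infinitesimal neighbourhoods of ITS OWN points factor is open; with connectedness it is everything

Layer `Literature/AlgebraicGeometry/Morphisms`, namespace `Literature.AlgebraicGeometry.Morphisms`.  THEOREMS ONLY (no definition,
no named fact, no instance, no notation).  Cell `hodgecm-mathlib` (D-0151), F-2d road (R-def) «theorem of the cube over a
NON-reduced base», brick D3‴ (author B-p07 (g16)): the CONNECTEDNESS form of ★ D3″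
`IsClosedImmersion.isIso_of_forall_infinitesimal_factors` ([MumfordAV1970] §6, proof of the theorem of the cube: «the closed
subscheme of the seesaw theorem contains the point `z₀` together with all its infinitesimal neighbourhoods, hence is open and
closed, hence everything since `Z` is connected»; [GortzWedhorn2023] Lemma 24.72).

Let `i : Z → W` be a closed immersion into a locally noetherian scheme such that for every point `t` IN THE IMAGE of `i` and every
`n` the infinitesimal neighbourhood `Spec(𝒪_{W,t}/𝔪_t^{n+1}) → W` factors through `i`.  Then:
* `IsClosedImmersion.exists_fromSpecResidueField_fac` — (any closed immersion) the point `Spec κ(i z) → W` factors through `i`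
  (the residue field map of a closed immersion is bijective);
* `IsClosedImmersion.isOpen_range_of_forall_infinitesimal_factors` — the image of `i` is OPEN: at an image point `t` choose an
  affine `U ∋ t` with injective germ map (Mathlib `Scheme.IsGermInjective` of locally noetherian schemes); every section of the
  ideal of `Z` on `U` has germ `0` at `t` (Krull, ★ `germ_eq_zero_of_forall_factors`), hence is `0`, so `U ⊆ supp(𝒪/𝓘) = im(i)`;
* `eq_univ_of_isClopen_of_forall_isPreconnected` — a clopen set met by a preconnected set through every point is everything;
* **`IsClosedImmersion.isIso_of_forall_infinitesimal_factors_of_isPreconnected`** — if moreover every point of `W` lies in a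
  preconnected subset of `W` meeting the image (e.g. a connected fibre through a section), `i` is an isomorphism (★ D3″).

HC_CM is proved only modulo the 7 printed citations until rung 0 closes; nothing here is about HC.

## References
* [MumfordAV1970] D. Mumford, *Abelian Varieties* (1970), §6, theorem of the cube (proof: open and closed), §10 (seesaw).
* [GortzWedhorn2023] U. Görtz, T. Wedhorn, *Algebraic Geometry II* (2023), Lemma 24.72 (p. 409).
* [StacksProject] The Stacks Project, Tag 01QN (closed immersions and ideal sheaves), Tag 00IP (Krull's intersection theorem).
-/

noncomputable section

universe u

open CategoryTheory AlgebraicGeometry IsLocalRing TopologicalSpace Opposite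

namespace Literature.AlgebraicGeometry.Morphisms

variable {W : Scheme.{u}}

/-- **The points of a closed subscheme factor through it**: for a closed immersion `i : Z → W` and `z ∈ Z`, the point
`Spec κ(i z) → W` factors through `i` (the residue field map `κ(i z) → κ(z)` is surjective — stalks surject — and injective — a field).
[cite: StacksProject, Tag 01QN] -/
theorem IsClosedImmersion.exists_fromSpecResidueField_fac {Z : Scheme.{u}} (i : Z ⟶ W) [IsClosedImmersion i] (z : Z) :
    ∃ v : Spec (W.residueField (i.base z)) ⟶ Z, v ≫ i = W.fromSpecResidueField (i.base z) := by
  have hsurj : Function.Surjective (i.residueFieldMap z) := by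
    intro y
    obtain ⟨b, rfl⟩ := Z.residue_surjective z y
    obtain ⟨a, rfl⟩ := i.stalkMap_surjective z b
    exact ⟨W.residue _ a, by rw [← CommRingCat.comp_apply, Scheme.residue_residueFieldMap, CommRingCat.comp_apply]⟩
  let e := RingEquiv.ofBijective (i.residueFieldMap z).hom ⟨(i.residueFieldMap z).hom.injective, hsurj⟩
  haveI : IsIso (i.residueFieldMap z) :=
    ⟨CommRingCat.ofHom e.symm.toRingHom, CommRingCat.hom_ext (RingHom.ext fun a => e.symm_apply_apply a),
      CommRingCat.hom_ext (RingHom.ext fun a => e.apply_symm_apply a)⟩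
  refine ⟨Spec.map (inv (i.residueFieldMap z)) ≫ Z.fromSpecResidueField z, ?_⟩
  rw [Category.assoc, ← Scheme.Hom.SpecMap_residueFieldMap_fromSpecResidueField, ← Spec.map_comp_assoc, IsIso.hom_inv_id,
    Spec.map_id, Category.id_comp]

/-- **A closed subscheme through which all infinitesimal neighbourhoods of its own points factor is OPEN** (locally noetherian
`W`): see the module docstring. [cite: MumfordAV1970, §6 (theorem of the cube, proof: the subscheme is open)]
[cite: StacksProject, Tag 00IP] -/
theorem IsClosedImmersion.isOpen_range_of_forall_infinitesimal_factors [IsLocallyNoetherian W] {Z : Scheme.{u}} (i : Z ⟶ W)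
    [IsClosedImmersion i]
    (h : ∀ t ∈ Set.range i.base, ∀ n : ℕ,
      ∃ v : Spec (.of (W.presheaf.stalk t ⧸ maximalIdeal (W.presheaf.stalk t) ^ (n + 1))) ⟶ Z,
        v ≫ i = Spec.map (CommRingCat.ofHom (Ideal.Quotient.mk (maximalIdeal (W.presheaf.stalk t) ^ (n + 1)))) ≫
          W.fromSpecStalk t) :
    IsOpen (Set.range i.base) := by
  rw [isOpen_iff_forall_mem_open]
  intro t ht
  obtain ⟨U, htU, hU, hinj⟩ := W.exists_germ_injective t
  refine ⟨U, fun u hu => ?_, U.isOpen, htU⟩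
  -- the ideal of `Z` vanishes on `U`
  have hJ : i.ker.ideal ⟨U, hU⟩ = ⊥ := by
    refine (Submodule.eq_bot_iff _).2 fun s hs => hinj ?_
    rw [map_zero]
    exact germ_eq_zero_of_forall_factors i t (h t ht) ⟨U, hU⟩ htU s hs
  -- so `U ⊆ supp(𝒪/𝓘) = closure (im i) = im i`
  have hsupp : u ∈ i.ker.support := by
    rw [Scheme.IdealSheafData.mem_support_iff_of_mem (U := ⟨U, hU⟩) hu, hJ, Scheme.mem_zeroLocus_iff]
    intro f hf
    rw [SetLike.mem_coe, Ideal.mem_bot] at hf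
    rw [hf, Scheme.basicOpen_zero]
    exact fun hu' => hu'
  have hsupp' : u ∈ (i.ker.support : Set W) := hsupp
  rwa [Scheme.Hom.support_ker, i.isClosedEmbedding.isClosed_range.closure_eq] at hsupp'

/-- A clopen subset met, through every point, by a preconnected subset meeting it is everything (topology; private plumbing).
[folklore] -/
private theorem eq_univ_of_isClopen_of_forall_isPreconnected {α : Type*} [TopologicalSpace α] {S : Set α} (hS : IsClopen S)
    (hconn : ∀ t : α, ∃ C : Set α, _root_.IsPreconnected C ∧ t ∈ C ∧ (C ∩ S).Nonempty) : S = Set.univ :=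
  Set.eq_univ_of_forall fun t => by
    obtain ⟨C, hC, htC, hne⟩ := hconn t
    exact hC.subset_isClopen hS hne htC

/-- **Connectedness form of ★ `IsClosedImmersion.isIso_of_forall_infinitesimal_factors`** ([MumfordAV1970] §6, proof of the
theorem of the cube): a closed immersion `i : Z → W` into a locally noetherian scheme through which all infinitesimal
neighbourhoods of its own points factor, and whose image meets a preconnected subset through every point of `W`, is an
isomorphism. [cite: MumfordAV1970, §6 (theorem of the cube, proof: open and closed, hence everything)]
[cite: GortzWedhorn2023, Lemma 24.72 (p. 409)] -/
theorem IsClosedImmersion.isIso_of_forall_infinitesimal_factors_of_isPreconnected [IsLocallyNoetherian W] {Z : Scheme.{u}}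
    (i : Z ⟶ W) [IsClosedImmersion i]
    (h : ∀ t ∈ Set.range i.base, ∀ n : ℕ,
      ∃ v : Spec (.of (W.presheaf.stalk t ⧸ maximalIdeal (W.presheaf.stalk t) ^ (n + 1))) ⟶ Z,
        v ≫ i = Spec.map (CommRingCat.ofHom (Ideal.Quotient.mk (maximalIdeal (W.presheaf.stalk t) ^ (n + 1)))) ≫
          W.fromSpecStalk t)
    (hconn : ∀ t : W, ∃ C : Set W, _root_.IsPreconnected C ∧ t ∈ C ∧ (C ∩ Set.range i.base).Nonempty) : IsIso i := by
  have hr : Set.range i.base = Set.univ :=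
    eq_univ_of_isClopen_of_forall_isPreconnected
      ⟨i.isClosedEmbedding.isClosed_range, IsClosedImmersion.isOpen_range_of_forall_infinitesimal_factors i h⟩ hconn
  exact IsClosedImmersion.isIso_of_forall_infinitesimal_factors i fun t n => h t (hr ▸ Set.mem_univ t) n

/-- The image of such a closed immersion is all of `W` (set-theoretic form, for consumers that feed ★ D5c-β pointwise).
[cite: MumfordAV1970, §6 (theorem of the cube, proof: open and closed, hence everything)] -/
theorem IsClosedImmersion.mem_range_of_forall_infinitesimal_factors_of_isPreconnected [IsLocallyNoetherian W] {Z : Scheme.{u}}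
    (i : Z ⟶ W) [IsClosedImmersion i]
    (h : ∀ t ∈ Set.range i.base, ∀ n : ℕ,
      ∃ v : Spec (.of (W.presheaf.stalk t ⧸ maximalIdeal (W.presheaf.stalk t) ^ (n + 1))) ⟶ Z,
        v ≫ i = Spec.map (CommRingCat.ofHom (Ideal.Quotient.mk (maximalIdeal (W.presheaf.stalk t) ^ (n + 1)))) ≫
          W.fromSpecStalk t)
    (hconn : ∀ t : W, ∃ C : Set W, _root_.IsPreconnected C ∧ t ∈ C ∧ (C ∩ Set.range i.base).Nonempty) (t : W) :
    t ∈ Set.range i.base := by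
  rw [eq_univ_of_isClopen_of_forall_isPreconnected
    ⟨i.isClosedEmbedding.isClosed_range, IsClosedImmersion.isOpen_range_of_forall_infinitesimal_factors i h⟩ hconn]
  exact Set.mem_univ t

end Literature.AlgebraicGeometry.Morphisms

end
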